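import Literature.Analysis.FluidPDE.SuitableWeak
import Literature.Analysis.FluidPDE.WeakSolutionProofs
import Literature.Analysis.FluidPDE.NSSuitableESSProofs
import HarnessLib

/-!
# Suitable weak solutions: exhaustion of the domain (gluing local solutions)

Analysis/FluidPDE support file over the accepted structures `IsDistributionalNSSolutionOn`
(`WeakSolution.lean`; Caffarelli–Kohn–Nirenberg 1982, (2.1)–(2.2)), `HasWeakSpatialGradientOn` and
`IsSuitableWeakSolutionOn` (`SuitableWeak.lean`; CKN 1982, (2.1)–(2.5); Lin 1998, Def. 1). No new
definitions.

All three notions are *local*: they are tested against compactly supported test functions and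
their integrability classes are required on compact subsets only. Hence they glue along an
**exhaustion**: if `Q₀ ≤ Q₁ ≤ ⋯ ≤ Q` are open space–time regions such that every compact subset of
`Q` lies in some `Qₙ`, then a pair `(u, p)` which is a distributional (resp. suitable weak)
solution on every `Qₙ` is one on `Q`:

* `IsDistributionalNSSolutionOn.of_exhaustion` — local integrability is a statement about compact
  sets (`MeasureTheory.locallyIntegrableOn_iff` on the open sets `Q`, `Qₙ`), and a test field on
  `Q` is supported in some `Qₙ`, outside of which the weak integrands vanish, so the integrals over
  `Q` and over `Qₙ` agree (`setIntegral_eq_of_subset_of_forall_sdiff_eq_zero`; the mirror image of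
  the accepted restriction lemma `IsDistributionalNSSolutionOn.mono_holds`).
* `exists_hasWeakSpatialGradientOn_of_exhaustion` — weak spatial gradients `Gₙ` of `u` on the `Qₙ`
  glue to a weak spatial gradient `G` of `u` on `Q` with `G = Gₙ` a.e. on every `Qₙ`: put
  `G(z) = G_{n(z)}(z)` for the least `n(z)` with `z ∈ Q_{n(z)}`; since weak gradients are a.e.
  unique (`HasWeakSpatialGradientOn.ae_eq`, Evans *PDE* §5.2.1) and the family is monotone,
  `G = Gₙ` a.e. on `Qₙ`, and the integration-by-parts identity against a test function supported
  in `Qₙ` is that of `Gₙ` (iterated integrals of a.e. equal integrands, `Measure.ae_ae_of_ae_prod`).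
* `IsSuitableWeakSolutionOn.of_exhaustion` — the energy, pressure and dissipation classes on a
  compact `K ⊆ Qₙ` and the local energy inequality (2.5) for `φ ≥ 0` supported in `Qₙ` are those
  of `(u, p)` on `Qₙ`, written with the glued gradient.

This is the standard localisation remark for CKN's definition (Caffarelli–Kohn–Nirenberg 1982,
§2: all conditions are imposed on compact subcylinders `D' ⊂⊂ D`); it is used to pass from
solutions on an increasing family of cylinders exhausting a slab to the slab itself (e.g. for
discretely self-similar solutions, Bradshaw–Tsai 2019, §4.3, "a similar re-scaling argument").

## References

* L. Caffarelli, R. Kohn, L. Nirenberg, *Partial regularity of suitable weak solutions of the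
  Navier–Stokes equations*, Comm. Pure Appl. Math. 35 (1982), §2, (2.1)–(2.5).
* L. C. Evans, *Partial differential equations*, 2nd ed. (AMS 2010), §5.2.1 (uniqueness of weak
  derivatives).
* Z. Bradshaw, T.-P. Tsai, *Discretely self-similar solutions to the Navier–Stokes equations with
  data in `L²_loc` satisfying the local energy inequality*, Analysis & PDE 12 (2019), §4.3.
-/

noncomputable section

open MeasureTheory TopologicalSpace Set Function Filter
open scoped InnerProductSpace RealInnerProductSpace ENNReal NNReal Laplacian Topology

namespace Literature.Analysis.FluidPDE

variable {E : Type*} [NormedAddCommGroup E] [InnerProductSpace ℝ E] [FiniteDimensional ℝ E]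
  [MeasurableSpace E] [BorelSpace E]

section Exhaustion

variable {Q : Opens (ℝ × E)} {Qn : ℕ → Opens (ℝ × E)} {ν : ℝ} {f u : ℝ → E → E} {p : ℝ → E → ℝ}

omit [FiniteDimensional ℝ E] [MeasurableSpace E] [BorelSpace E] in
/-- A space–time test field on `Q` whose (compact) support lies in the open set `Q'` is a
space–time test field on `Q'`. [folklore] -/
theorem IsSpaceTimeTestOn.of_tsupport_subset {F : Type*} [NormedAddCommGroup F] [NormedSpace ℝ F]
    {Q' : Opens (ℝ × E)} {ψ : ℝ → E → F} (hψ : IsSpaceTimeTestOn Q ψ)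
    (h : tsupport (uncurry ψ) ⊆ (Q' : Set (ℝ × E))) : IsSpaceTimeTestOn Q' ψ :=
  ⟨hψ.contDiff, hψ.hasCompactSupport, h⟩

/-- Local integrability on an open space–time region is integrability on its compact subsets
(`MeasureTheory.locallyIntegrableOn_iff`). [folklore] -/
theorem locallyIntegrableOn_opens_iff {F : Type*} [NormedAddCommGroup F] {g : ℝ × E → F}
    {Q' : Opens (ℝ × E)} :
    LocallyIntegrableOn g (Q' : Set (ℝ × E)) volume ↔
      ∀ K ⊆ (Q' : Set (ℝ × E)), IsCompact K → IntegrableOn g K volume :=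
  locallyIntegrableOn_iff Q'.isOpen.isLocallyClosed

/-- Local integrability glues along an exhaustion: if every compact subset of the open set `Q`
lies in some open `Qₙ` on which `g` is locally integrable, then `g` is locally integrable on
`Q`. [folklore] -/
theorem locallyIntegrableOn_of_exhaustion {F : Type*} [NormedAddCommGroup F] {g : ℝ × E → F}
    (hcov : ∀ K ⊆ (Q : Set (ℝ × E)), IsCompact K → ∃ n, K ⊆ (Qn n : Set (ℝ × E)))
    (h : ∀ n, LocallyIntegrableOn g (Qn n : Set (ℝ × E)) volume) :
    LocallyIntegrableOn g (Q : Set (ℝ × E)) volume := by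
  refine locallyIntegrableOn_opens_iff.2 fun K hK hKc => ?_
  obtain ⟨n, hn⟩ := hcov K hK hKc
  exact locallyIntegrableOn_opens_iff.1 (h n) K hn hKc

/-- **Distributional solutions glue along an exhaustion.** Let `Q` be an open space–time region
and `Qₙ ≤ Q` open sets such that every compact subset of `Q` lies in some `Qₙ`. If `(u, p)` is a
distributional solution of the forced Navier–Stokes system on every `Qₙ`, it is one on `Q`: local
integrability is tested on compact sets, and a test field on `Q` is a test field on some `Qₙ`,
outside of which the weak integrands vanish (Caffarelli–Kohn–Nirenberg 1982, §2: the conditions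
(2.1)–(2.2) are local). [cite: CaffarelliKohnNirenberg1982, §2] -/
theorem IsDistributionalNSSolutionOn.of_exhaustion (hle : ∀ n, Qn n ≤ Q)
    (hcov : ∀ K ⊆ (Q : Set (ℝ × E)), IsCompact K → ∃ n, K ⊆ (Qn n : Set (ℝ × E)))
    (h : ∀ n, IsDistributionalNSSolutionOn (Qn n) ν f u p) :
    IsDistributionalNSSolutionOn Q ν f u p := by
  refine ⟨locallyIntegrableOn_of_exhaustion hcov fun n => (h n).1,
    locallyIntegrableOn_of_exhaustion hcov fun n => (h n).2.1,
    locallyIntegrableOn_of_exhaustion hcov fun n => (h n).2.2.1, fun θ hθ => ?_, fun ψ hψ => ?_⟩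
  · obtain ⟨n, hn⟩ := hcov _ hθ.tsupport_subset hθ.hasCompactSupport
    have hθn : IsSpaceTimeTestOn (Qn n) θ := hθ.of_tsupport_subset hn
    have key := (h n).2.2.2.1 θ hθn
    have hQs : ((Qn n : Opens (ℝ × E)) : Set (ℝ × E)) ⊆ (Q : Set (ℝ × E)) := hle n
    rw [setIntegral_eq_of_subset_of_forall_sdiff_eq_zero Q.isOpen.measurableSet hQs]
    · exact key
    · rintro ⟨t, x⟩ hz
      have hg : gradient (θ t) x = 0 := by
        rw [gradient, hθn.fderiv_slice_eq_zero hz.2, map_zero]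
      simp [hg]
  · obtain ⟨n, hn⟩ := hcov _ hψ.tsupport_subset hψ.hasCompactSupport
    have hψn : IsSpaceTimeTestOn (Qn n) ψ := hψ.of_tsupport_subset hn
    have key := (h n).2.2.2.2 ψ hψn
    have hQs : ((Qn n : Opens (ℝ × E)) : Set (ℝ × E)) ⊆ (Q : Set (ℝ × E)) := hle n
    rw [setIntegral_eq_of_subset_of_forall_sdiff_eq_zero Q.isOpen.measurableSet hQs]
    · exact key
    · rintro ⟨t, x⟩ hz
      have h1 : deriv (fun s => ψ s x) t = 0 := hψn.deriv_eq_zero hz.2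
      have h2 : fderiv ℝ (ψ t) x = 0 := hψn.fderiv_slice_eq_zero hz.2
      have h3 : Δ (ψ t) x = 0 := hψn.laplacian_slice_eq_zero hz.2
      have h4 : ψ t x = 0 := hψn.apply_eq_zero hz.2
      have h5 : VectorCalculus.divergence (ψ t) x = 0 := by simp [VectorCalculus.divergence, h2]
      simp [h1, convect, h2, h3, h4, h5]

/-- Iterated integrals of two space–time integrands which agree a.e. for the product Lebesgue
measure on `ℝ × E` coincide (`Measure.ae_ae_of_ae_prod` and `integral_congr_ae` twice). [folklore] -/
theorem integral_integral_congr_ae_prod {F : Type*} [NormedAddCommGroup F] [NormedSpace ℝ F]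
    {H₁ H₂ : ℝ → E → F}
    (h : ∀ᵐ z : ℝ × E ∂volume, H₁ z.1 z.2 = H₂ z.1 z.2) :
    ∫ t, ∫ x, H₁ t x = ∫ t, ∫ x, H₂ t x := by
  have h' : ∀ᵐ z : ℝ × E ∂(volume : Measure ℝ).prod (volume : Measure E), H₁ z.1 z.2 = H₂ z.1 z.2 := by
    rwa [← Measure.volume_eq_prod]
  have h2 := Measure.ae_ae_of_ae_prod (p := fun z : ℝ × E => H₁ z.1 z.2 = H₂ z.1 z.2) h'
  refine integral_congr_ae ?_
  filter_upwards [h2] with t ht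
  exact integral_congr_ae ht

/-- **Gluing weak spatial gradients along a monotone exhaustion.** Let `Q₀ ≤ Q₁ ≤ ⋯ ≤ Q` be open
space–time regions such that every compact subset of `Q` lies in some `Qₙ`, and let `Gₙ` be a
weak spatial gradient of `u` on `Qₙ`. Then `u` has a weak spatial gradient `G` on `Q` which agrees
with `Gₙ` a.e. on `Qₙ` for every `n`. (Take `G(z) = G_{n(z)}(z)` with `n(z)` the least index
with `z ∈ Q_{n(z)}`; weak gradients being a.e. unique — Evans, *PDE*, §5.2.1 — `G_k = G_n` a.e. on
`Q_k` for `k ≤ n`, whence `G = Gₙ` a.e. on `Qₙ`; the defining identity against a test function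
supported in `Qₙ` only sees `G` there.) [cite: Evans2010, §5.2.1 (uniqueness of weak derivatives)] -/
theorem exists_hasWeakSpatialGradientOn_of_exhaustion (hmono : Monotone Qn)
    (hcov : ∀ K ⊆ (Q : Set (ℝ × E)), IsCompact K → ∃ n, K ⊆ (Qn n : Set (ℝ × E)))
    {G : ℕ → ℝ → E → E →L[ℝ] E} (hG : ∀ n, HasWeakSpatialGradientOn (Qn n) u (G n)) :
    ∃ G' : ℝ → E → E →L[ℝ] E, HasWeakSpatialGradientOn Q u G' ∧
      ∀ n, ∀ᵐ z : ℝ × E ∂volume, z ∈ (Qn n : Set (ℝ × E)) → uncurry G' z = uncurry (G n) z := by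
  classical
  -- the glued gradient
  set G' : ℝ → E → E →L[ℝ] E := fun t x =>
    if h : ∃ n, (t, x) ∈ (Qn n : Set (ℝ × E)) then G (Nat.find h) t x else 0 with hG'
  -- pairwise agreement on the smaller set
  have hagree : ∀ k n, k ≤ n → ∀ᵐ z : ℝ × E ∂volume,
      z ∈ (Qn k : Set (ℝ × E)) → uncurry (G k) z = uncurry (G n) z := fun k n hkn =>
    ae_imp_of_ae_restrict ((hG k).ae_eq ((hG n).mono (hmono hkn)))
  have hG'ae : ∀ n, ∀ᵐ z : ℝ × E ∂volume,
      z ∈ (Qn n : Set (ℝ × E)) → uncurry G' z = uncurry (G n) z := by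
    intro n
    have hall : ∀ᵐ z : ℝ × E ∂volume, ∀ k, k ≤ n → z ∈ (Qn k : Set (ℝ × E)) →
        uncurry (G k) z = uncurry (G n) z := by
      refine ae_all_iff.2 fun k => ?_
      by_cases hkn : k ≤ n
      · filter_upwards [hagree k n hkn] with z hz hk using hz
      · exact Eventually.of_forall fun z hk => absurd hk hkn
    filter_upwards [hall] with z hz hzn
    obtain ⟨t, x⟩ := z
    have hex : ∃ m, (t, x) ∈ (Qn m : Set (ℝ × E)) := ⟨n, hzn⟩
    have hval : uncurry G' (t, x) = G (Nat.find hex) t x := by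
      simp only [uncurry_apply_pair, hG', dif_pos hex]
    rw [hval]
    exact hz (Nat.find hex) (Nat.find_min' hex hzn) (Nat.find_spec hex)
  refine ⟨G', ⟨?_, ?_, ?_⟩, hG'ae⟩
  · exact locallyIntegrableOn_of_exhaustion hcov fun n => (hG n).locallyIntegrableOn
  · refine locallyIntegrableOn_opens_iff.2 fun K hK hKc => ?_
    obtain ⟨n, hn⟩ := hcov K hK hKc
    have hint : IntegrableOn (uncurry (G n)) K volume :=
      locallyIntegrableOn_opens_iff.1 (hG n).locallyIntegrableOn_grad K hn hKc
    refine hint.congr_fun_ae ?_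
    have h1 : ∀ᵐ z : ℝ × E ∂volume, z ∈ K → uncurry (G n) z = uncurry G' z := by
      filter_upwards [hG'ae n] with z hz hzK using (hz (hn hzK)).symm
    exact (ae_restrict_iff' hKc.isClosed.measurableSet).2 h1
  · intro φ hφ v w
    obtain ⟨n, hn⟩ := hcov _ hφ.tsupport_subset hφ.hasCompactSupport
    have hφn : IsSpaceTimeTestOn (Qn n) φ := hφ.of_tsupport_subset hn
    rw [(hG n).integral_fderiv_mul_inner_eq φ hφn v w]
    congr 1
    refine integral_integral_congr_ae_prod ?_
    filter_upwards [hG'ae n] with z hz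
    by_cases hzQ : z ∈ (Qn n : Set (ℝ × E))
    · have e : G' z.1 z.2 = G n z.1 z.2 := hz hzQ
      rw [e]
    · have h0 : φ z.1 z.2 = 0 := hφn.apply_eq_zero (t := z.1) (x := z.2) hzQ
      simp [h0]

/-- Lower integrals over a compact (closed) subset of `Qₙ` of integrands built from two a.e. equal
gradients agree. [folklore] -/
theorem setLIntegral_congr_of_ae_imp {K S : Set (ℝ × E)} (hK : MeasurableSet K) (hKS : K ⊆ S)
    {g₁ g₂ : ℝ × E → ℝ≥0∞} (h : ∀ᵐ z : ℝ × E ∂volume, z ∈ S → g₁ z = g₂ z) :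
    ∫⁻ z in K, g₁ z = ∫⁻ z in K, g₂ z := by
  refine setLIntegral_congr_fun_ae hK ?_
  filter_upwards [h] with z hz hzK using hz (hKS hzK)

/-- **Suitable weak solutions glue along a monotone exhaustion.** Let `Q₀ ≤ Q₁ ≤ ⋯ ≤ Q` be open
space–time regions such that every compact subset of `Q` lies in some `Qₙ`. If `(u, p)` is a
suitable weak solution of the forced Navier–Stokes system (Caffarelli–Kohn–Nirenberg 1982,
(2.1)–(2.5)) on every `Qₙ`, then it is a suitable weak solution on `Q`: the distributional
equations glue (`IsDistributionalNSSolutionOn.of_exhaustion`), the classes `u ∈ L^∞_t L²_x`,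
`p ∈ L^{3/2}`, `∇u ∈ L²` on a compact `K ⊆ Q` are read off on a `Qₙ ⊇ K`, and with the glued weak
gradient (`exists_hasWeakSpatialGradientOn_of_exhaustion`) the local energy inequality (2.5) for a
nonnegative test function supported in `Qₙ` is the one on `Qₙ` (CKN 1982, §2: all conditions in
the definition are local). [cite: CaffarelliKohnNirenberg1982, §2] -/
theorem IsSuitableWeakSolutionOn.of_exhaustion (hle : ∀ n, Qn n ≤ Q) (hmono : Monotone Qn)
    (hcov : ∀ K ⊆ (Q : Set (ℝ × E)), IsCompact K → ∃ n, K ⊆ (Qn n : Set (ℝ × E)))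
    (h : ∀ n, IsSuitableWeakSolutionOn (Qn n) ν f u p) :
    IsSuitableWeakSolutionOn Q ν f u p := by
  choose G hG hG2 hloc using fun n => (h n).localEnergy
  obtain ⟨G', hG', hG'ae⟩ := exists_hasWeakSpatialGradientOn_of_exhaustion hmono hcov hG
  refine
    { distributional :=
        IsDistributionalNSSolutionOn.of_exhaustion hle hcov fun n => (h n).distributional
      energyClass := fun K hK hKc => ?_
      pressure := fun K hK hKc => ?_
      localEnergy := ⟨G', hG', fun K hK hKc => ?_, fun φ hφ hφ0 => ?_⟩ }
  · obtain ⟨n, hn⟩ := hcov K hK hKc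
    exact (h n).energyClass K hn hKc
  · obtain ⟨n, hn⟩ := hcov K hK hKc
    exact (h n).pressure K hn hKc
  · obtain ⟨n, hn⟩ := hcov K hK hKc
    have e : ∫⁻ z in K, ENNReal.ofReal (frobeniusNormSq (G' z.1 z.2)) =
        ∫⁻ z in K, ENNReal.ofReal (frobeniusNormSq (G n z.1 z.2)) := by
      refine setLIntegral_congr_of_ae_imp hKc.isClosed.measurableSet hn ?_
      filter_upwards [hG'ae n] with z hz hzS
      have e : G' z.1 z.2 = G n z.1 z.2 := hz hzS
      rw [e]
    rw [e]
    exact hG2 n K hn hKc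
  · obtain ⟨n, hn⟩ := hcov _ hφ.tsupport_subset hφ.hasCompactSupport
    have hφn : IsSpaceTimeTestOn (Qn n) φ := hφ.of_tsupport_subset hn
    have e : ∫ t, ∫ x, frobeniusNormSq (G' t x) * φ t x =
        ∫ t, ∫ x, frobeniusNormSq (G n t x) * φ t x := by
      refine integral_integral_congr_ae_prod ?_
      filter_upwards [hG'ae n] with z hz
      by_cases hzQ : z ∈ (Qn n : Set (ℝ × E))
      · have e : G' z.1 z.2 = G n z.1 z.2 := hz hzQ
        rw [e]
      · have h0 : φ z.1 z.2 = 0 := hφn.apply_eq_zero (t := z.1) (x := z.2) hzQ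
        simp [h0]
    rw [e]
    exact hloc n φ hφn hφ0

end Exhaustion

end Literature.Analysis.FluidPDE

end
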